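import Summits.ResolutionOfSingularities.ResolutionOfSingularities.Theorems.FrobeniusClosingSteerOddBranchPersistence
import Summits.ResolutionOfSingularities.ResolutionOfSingularities.Theorems.FrobeniusClosingSteerQuadraticStepLemmas

/-!
# Crux `Steer` (stmt-ResolutionOfSingularities-16345), chain W4.1: a PERSISTENT exceptional parameter along a VALUED chain of
# local members forces a DISCRETE valuation — PERSIST(c, d) in valued words is the V-free squeeze
# (res-L0-w41-plan-1 RULING 108b / 112d (iii) «hG4 ⟸ PERSIST(4) ⟸ NoTangentialStepFour»; res-L0-w41-idea-3 g5 Sketch-g5 §2;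
# res-type-062 g15 INPUT 11:58:12Z; Theses-free support)

OURS (campaign `res-hironaka`, rung L ★L-G4, slot W4.1; statements about the route's own objects — an increasing chain of LOCAL
subrings `S 0 ≤ S 1 ≤ ⋯` of a field `L` (the chain currency of the K♭ / G words: `hle`, `x m`, the span clause
`𝔪_(S m)·S (m+1) = (x m)`), here together with a valuation ring `O ⊇ S m`; they replace the role of no printed item and are NOT
statements of the manuscript under review [claim: Hironaka2017, status: under-review]; AI review is weaker than expert review).
Seat res-type-062 g15. Definition-free; no Theses file of W4.1 is imported; nothing here is a route item.

## The point

res-L0-w41-idea-3 g5's lever for G-perf(c, d) is «no tangential step»: in the chain currency, the exceptional parameter PERSISTS,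
`Ideal.span {x m} = Ideal.span {x (m+1)}` in `S (m+2)` for every `m` (Sketch-g5 `NoTangentialStepPerfect`). Its companion
`NoEternalPersistentChainPerfect` (PERSIST(c, d): such a chain cannot exist) is stated WITHOUT a valuation and then needs the formal-arc
programme. This file proves the VALUED form at once: if the members lie in a valuation ring `O` which dominates them
(`y ∈ 𝔪_(S m) → v y < 1`), `O` has no proper coarsening, and `z ^ N` (`N ≠ 0`) of every `z ≠ 0` is a quotient of non-zero elements of
`S 0` (the torsor fraction datum, `N = p`: `OddBranchPersistence.exists_pow_eq_div_of_isFractionRing_adjoin`), then persistence forces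
`Discrete O` — by tri-1's V-free squeeze `OddBranchVFree.discrete_of_persistent'`, exactly as in the (Par-P) leaf: the span clause and
persistence give `𝔪_(S m)·S (m+1) = x₀·S (m+1)` for the FIRST parameter `x₀ = x 0` and all `m`, hence the weak persistence clause
«`y ∈ S m`, `v y < 1` ⇒ `y / x₀ ∈ S (m+1)`». For a chain packaged from a `CoreDatum` run (`¬ Discrete O`) this is absurd: the radicand,
the law, isolatedness and the residue fields play no role. So, in VALUED words, hG4's line reduces to «no tangential step» alone.

* `mem_span_image_maximalIdeal` / `exists_eq_mul_excParam` — the span clause read elementwise: `y ∈ 𝔪_(S m)` ⇒ `y = r · x m`, `r ∈ S (m+1)`.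
* `excParam_ne_zero_of_maximalIdeal_ne_bot`, `maximalIdeal_ne_bot_of_ringKrullDim_ne_zero` — `x 0 ≠ 0` for a member of positive dimension.
* `exists_unit_mul_eq_of_persistent` — persistence ⇒ `x m = u · x 0` with `u` a unit of `S (m+1)` (so `x 0` divides `x m` and conversely).
* `weakPersistence_of_persistent` — the weak persistence clause of `OddBranchVFree` for `x 0` along the whole chain.
* `discrete_of_persistentChain` — **PERSIST-V**: the valued persistent chain forces `Discrete O`; `false_of_persistentChain` — with `¬ Discrete O`.

[cite: NovacoskiSpivakovsky2014, Def. 2.11] [cite: HeinzerEtAl2015, Remark 2.4] [folklore]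
-/

-- `Summit.<S>.<S>.…` duplicates the summit name by design (single-problem summit).
set_option linter.dupNamespace false

open IsLocalRing

namespace Summit.ResolutionOfSingularities.ResolutionOfSingularities.Theorems.SwitchingDichotomy

namespace PersistentChainValued

open Summit.ResolutionOfSingularities.ResolutionOfSingularities.Theorems.SteerRankThinness (HasProperCoarsening)
open Summit.ResolutionOfSingularities.ResolutionOfSingularities.Theorems.SwitchingDichotomy.Words (Discrete)

variable {L : Type} [Field L]

/-! ## §1 The span clause read elementwise; the first exceptional parameter is non-zero -/

section Span

variable {S : ℕ → Subring L} [∀ m, IsLocalRing (S m)] {hle : ∀ m, S m ≤ S (m + 1)} {x : ∀ m, S (m + 1)}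

/-- The span clause `𝔪_(S m)·S (m+1) = (x m)` elementwise: the image of `y ∈ 𝔪_(S m)` lies in `Ideal.span {x m}`. [folklore] -/
theorem mem_span_image_maximalIdeal
    (hspan : ∀ m, Ideal.span ((fun y : S m => (⟨(y : L), hle m y.2⟩ : S (m + 1))) '' (maximalIdeal (S m) : Set (S m)))
        = Ideal.span {x m})
    (m : ℕ) {y : S m} (hy : y ∈ maximalIdeal (S m)) : (⟨(y : L), hle m y.2⟩ : S (m + 1)) ∈ Ideal.span {x m} := by
  rw [← hspan m]
  exact Ideal.subset_span ⟨y, hy, rfl⟩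

/-- The span clause elementwise, in `L`: `y ∈ 𝔪_(S m)` ⇒ `y = r · x m` for some `r ∈ S (m+1)`. [folklore] -/
theorem exists_eq_mul_excParam
    (hspan : ∀ m, Ideal.span ((fun y : S m => (⟨(y : L), hle m y.2⟩ : S (m + 1))) '' (maximalIdeal (S m) : Set (S m)))
        = Ideal.span {x m})
    (m : ℕ) {y : S m} (hy : y ∈ maximalIdeal (S m)) : ∃ r ∈ S (m + 1), (y : L) = r * ((x m : S (m + 1)) : L) := by
  obtain ⟨a, ha⟩ := Ideal.mem_span_singleton'.mp (mem_span_image_maximalIdeal hspan m hy)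
  refine ⟨a, a.2, ?_⟩
  have := congrArg (fun z : S (m + 1) => (z : L)) ha
  simpa using this.symm

/-- If `𝔪_(S 0) ≠ ⊥` then the first exceptional parameter `x 0` is non-zero (else the span clause would kill `𝔪_(S 0)`). [folklore] -/
theorem excParam_ne_zero_of_maximalIdeal_ne_bot
    (hspan : ∀ m, Ideal.span ((fun y : S m => (⟨(y : L), hle m y.2⟩ : S (m + 1))) '' (maximalIdeal (S m) : Set (S m)))
        = Ideal.span {x m})
    (h0 : maximalIdeal (S 0) ≠ ⊥) : ((x 0 : S 1) : L) ≠ 0 := by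
  intro hx
  apply h0
  rw [eq_bot_iff]
  intro y hy
  obtain ⟨r, -, hr⟩ := exists_eq_mul_excParam hspan 0 hy
  rw [hx, mul_zero] at hr
  exact (Submodule.mem_bot _).mpr (Subtype.ext hr)

omit [∀ m, IsLocalRing (S m)] in
/-- A local ring of non-zero Krull dimension has non-zero maximal ideal (a local ring with `𝔪 = ⊥` is a field, of dimension `0`). [folklore] -/
theorem maximalIdeal_ne_bot_of_ringKrullDim_ne_zero (m : ℕ) [IsLocalRing (S m)] (hdim : ringKrullDim (S m) ≠ 0) :
    maximalIdeal (S m) ≠ ⊥ := fun h =>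
  hdim (ringKrullDim_eq_zero_of_isField ((isField_iff_maximalIdeal_eq).mpr h))

end Span

/-! ## §2 Persistence: the first exceptional parameter generates every `𝔪_(S m)·S (m+1)` -/

section Persist

variable {S : ℕ → Subring L} [∀ m, IsLocalRing (S m)] {hle : ∀ m, S m ≤ S (m + 1)} {x : ∀ m, S (m + 1)}

omit [∀ m, IsLocalRing (S m)] in
/-- **Persistence along the chain.** If `Ideal.span {x m} = Ideal.span {x (m+1)}` in `S (m+2)` for every `m` (idea-3's «no tangential
step» conclusion), then `x m = u · x 0` in `L` with `u, u⁻¹ ∈ S (m+1)`: the FIRST exceptional parameter persists. [folklore] -/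
theorem exists_unit_mul_eq_of_persistent
    (hpers : ∀ m, Ideal.span {(⟨((x m : S (m + 1)) : L), hle (m + 1) (x m).2⟩ : S (m + 2))} = Ideal.span {x (m + 1)})
    (hx0 : ((x 0 : S 1) : L) ≠ 0) :
    ∀ m, ∃ u w : L, u ∈ S (m + 1) ∧ w ∈ S (m + 1) ∧ u * w = 1 ∧ ((x m : S (m + 1)) : L) = u * ((x 0 : S 1) : L) := by
  intro m
  induction m with
  | zero => exact ⟨1, 1, (S 1).one_mem, (S 1).one_mem, one_mul 1, (one_mul _).symm⟩
  | succ m ih =>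
    obtain ⟨u, w, hu, hw, huw, hxm⟩ := ih
    -- `x m` and `x (m+1)` are associated in `S (m+2)`
    have h1 : (⟨((x m : S (m + 1)) : L), hle (m + 1) (x m).2⟩ : S (m + 2)) ∈ Ideal.span {x (m + 1)} := by
      rw [← hpers m]; exact Ideal.mem_span_singleton_self _
    have h2 : x (m + 1) ∈ Ideal.span {(⟨((x m : S (m + 1)) : L), hle (m + 1) (x m).2⟩ : S (m + 2))} := by
      rw [hpers m]; exact Ideal.mem_span_singleton_self _
    obtain ⟨a, ha⟩ := Ideal.mem_span_singleton'.mp h1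
    obtain ⟨b, hb⟩ := Ideal.mem_span_singleton'.mp h2
    have ha' : ((a : S (m + 2)) : L) * ((x (m + 1) : S (m + 2)) : L) = ((x m : S (m + 1)) : L) := by
      have := congrArg (fun z : S (m + 2) => (z : L)) ha; simpa using this
    have hb' : ((b : S (m + 2)) : L) * ((x m : S (m + 1)) : L) = ((x (m + 1) : S (m + 2)) : L) := by
      have := congrArg (fun z : S (m + 2) => (z : L)) hb; simpa using this
    have hxm0 : ((x m : S (m + 1)) : L) ≠ 0 := by
      rw [hxm]
      have hu0 : u ≠ 0 := fun h => by rw [h, zero_mul] at huw; exact zero_ne_one huw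
      exact mul_ne_zero hu0 hx0
    -- `b * a = 1`
    have hba : ((b : S (m + 2)) : L) * (a : L) = 1 := by
      have h := hb'
      rw [← ha', ← mul_assoc] at h
      -- h : b * a * x(m+1) = x(m+1)
      have hx10 : ((x (m + 1) : S (m + 2)) : L) ≠ 0 := by
        intro h0; rw [h0, mul_zero] at ha'; exact hxm0 ha'.symm
      exact mul_right_cancel₀ hx10 (by rw [h, one_mul])
    refine ⟨(b : L) * u, w * (a : L), (S (m + 2)).mul_mem b.2 (hle (m + 1) hu),
      (S (m + 2)).mul_mem (hle (m + 1) hw) a.2, ?_, ?_⟩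
    · calc (b : L) * u * (w * (a : L)) = ((b : L) * (a : L)) * (u * w) := by ring
        _ = 1 := by rw [hba, huw, one_mul]
    · rw [← hb', hxm, mul_assoc]

/-- **The weak persistence clause from chain persistence.** Members `S m ⊆ O`; the span clause and persistence give: every
`y ∈ S m` of `O`-value `< 1` is divisible by the first exceptional parameter `x 0` in the next member. [folklore] -/
theorem weakPersistence_of_persistent {O : ValuationSubring L} (hSO : ∀ m, S m ≤ O.toSubring)
    (hspan : ∀ m, Ideal.span ((fun y : S m => (⟨(y : L), hle m y.2⟩ : S (m + 1))) '' (maximalIdeal (S m) : Set (S m)))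
        = Ideal.span {x m})
    (hpers : ∀ m, Ideal.span {(⟨((x m : S (m + 1)) : L), hle (m + 1) (x m).2⟩ : S (m + 2))} = Ideal.span {x (m + 1)})
    (hx0 : ((x 0 : S 1) : L) ≠ 0) :
    ∀ i, 0 ≤ i → ∀ y ∈ S i, O.valuation y < 1 → ∃ j, i < j ∧ y / ((x 0 : S 1) : L) ∈ S j := by
  intro i _ y hy hvy
  have hym : (⟨y, hy⟩ : S i) ∈ maximalIdeal (S i) :=
    QuadraticStep.mem_maximalIdeal_of_valuation_lt_one (hSO i) ⟨y, hy⟩ hvy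
  obtain ⟨r, hr, hyr⟩ := exists_eq_mul_excParam hspan i hym
  obtain ⟨u, w, hu, -, -, hxu⟩ := exists_unit_mul_eq_of_persistent hpers hx0 i
  refine ⟨i + 1, i.lt_succ_self, ?_⟩
  have : y / ((x 0 : S 1) : L) = r * u := by
    change (y : L) = _ at hyr
    rw [hyr, hxu, ← mul_assoc, mul_div_assoc, div_self hx0, mul_one]
  rw [this]
  exact (S (i + 1)).mul_mem hr hu

end Persist

/-! ## §3 PERSIST-V: a valued persistent chain forces a discrete valuation -/

section Valued

variable {S : ℕ → Subring L} [∀ m, IsLocalRing (S m)] {hle : ∀ m, S m ≤ S (m + 1)} {x : ∀ m, S (m + 1)}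

/-- **PERSIST-V.** Let `S 0 ≤ S 1 ≤ ⋯` be local subrings of `L` inside a valuation ring `O` which DOMINATES them
(`y ∈ 𝔪_(S m) ⇒ v y < 1`; needed only at `m ≤ 1`), with exceptional parameters `x m` (`𝔪_(S m)·S (m+1) = (x m)`, the span clause of the
K♭ / G words), `𝔪_(S 0) ≠ ⊥`, and PERSISTENCE `(x m) = (x (m+1))` in `S (m+2)` for all `m`. If `O` has no proper coarsening and some fixed
power `N ≠ 0` of every `z ≠ 0` is a quotient of non-zero elements of `S 0`, then `O` is discrete of rank one (`Words.Discrete`).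
(tri-1's V-free squeeze `OddBranchVFree.discrete_of_persistent'` along the chain with the first parameter `x 0`.)
[cite: HeinzerEtAl2015, Remark 2.4] [folklore] -/
theorem discrete_of_persistentChain (O : ValuationSubring L) (hSO : ∀ m, S m ≤ O.toSubring)
    (hdom : ∀ m (y : S m), y ∈ maximalIdeal (S m) → O.valuation (y : L) < 1)
    (hspan : ∀ m, Ideal.span ((fun y : S m => (⟨(y : L), hle m y.2⟩ : S (m + 1))) '' (maximalIdeal (S m) : Set (S m)))
        = Ideal.span {x m})
    (hpers : ∀ m, Ideal.span {(⟨((x m : S (m + 1)) : L), hle (m + 1) (x m).2⟩ : S (m + 2))} = Ideal.span {x (m + 1)})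
    (h0 : maximalIdeal (S 0) ≠ ⊥) (hnc : ¬ HasProperCoarsening O) {N : ℕ} (hN : N ≠ 0)
    (hK : ∀ z : L, z ≠ 0 → ∃ a ∈ S 0, ∃ b ∈ S 0, a ≠ 0 ∧ b ≠ 0 ∧ z ^ N = a / b) : Discrete O := by
  have hx0 : ((x 0 : S 1) : L) ≠ 0 := excParam_ne_zero_of_maximalIdeal_ne_bot hspan h0
  -- `x 0 ∈ 𝔪_(S 1)`, hence of value `< 1`
  have hxmax : (x 0 : S 1) ∈ maximalIdeal (S 1) := by
    have hle1 : Ideal.span ((fun y : S 0 => (⟨(y : L), hle 0 y.2⟩ : S 1)) '' (maximalIdeal (S 0) : Set (S 0)))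
        ≤ maximalIdeal (S 1) := by
      refine Ideal.span_le.mpr ?_
      rintro _ ⟨y, hy, rfl⟩
      exact QuadraticStep.mem_maximalIdeal_of_valuation_lt_one (hSO 1) _ (hdom 0 y hy)
    exact hle1 ((hspan 0).symm ▸ Ideal.mem_span_singleton_self (x 0))
  have hvx : O.valuation ((x 0 : S 1) : L) < 1 := hdom 1 _ hxmax
  have hxO : ((x 0 : S 1) : L) ∈ O := hSO 1 (x 0).2
  exact OddBranchVFree.discrete_of_persistent' O (fun m => S m) ((x 0 : S 1) : L) 0 N hSO ⟨hxO, hvx⟩ hx0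
    (weakPersistence_of_persistent hSO hspan hpers hx0) hnc hN hK

/-- **PERSIST-V, contradiction form** — with `¬ Discrete O` (e.g. a chain packaged from a `CoreDatum` run) a valued persistent chain
cannot exist. [folklore] -/
theorem false_of_persistentChain (O : ValuationSubring L) (hSO : ∀ m, S m ≤ O.toSubring)
    (hdom : ∀ m (y : S m), y ∈ maximalIdeal (S m) → O.valuation (y : L) < 1)
    (hspan : ∀ m, Ideal.span ((fun y : S m => (⟨(y : L), hle m y.2⟩ : S (m + 1))) '' (maximalIdeal (S m) : Set (S m)))
        = Ideal.span {x m})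
    (hpers : ∀ m, Ideal.span {(⟨((x m : S (m + 1)) : L), hle (m + 1) (x m).2⟩ : S (m + 2))} = Ideal.span {x (m + 1)})
    (h0 : maximalIdeal (S 0) ≠ ⊥) (hnc : ¬ HasProperCoarsening O) (hnd : ¬ Discrete O) {N : ℕ} (hN : N ≠ 0)
    (hK : ∀ z : L, z ≠ 0 → ∃ a ∈ S 0, ∃ b ∈ S 0, a ≠ 0 ∧ b ≠ 0 ∧ z ^ N = a / b) : False :=
  hnd (discrete_of_persistentChain O hSO hdom hspan hpers h0 hnc hN hK)

/-- **PERSIST-V in the torsor currency** (`N = p`): the fraction datum from `K = Frac k[A₀, t]`, `t ^ p ∈ A₀ ⊆ S 0`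
(`OddBranchPersistence.exists_pow_eq_div_of_isFractionRing_adjoin`). [folklore] -/
theorem false_of_persistentChain_torsor {k : Type} [Field k] [Algebra k L] (p : ℕ) (hp : p.Prime) [CharP L p]
    (A₀ : Subalgebra k L) (t : L) (htp : t ^ p ∈ A₀) (hfr : IsFractionRing (Algebra.adjoin k (insert t (A₀ : Set L))) L)
    (O : ValuationSubring L) (hSO : ∀ m, S m ≤ O.toSubring)
    (hdom : ∀ m (y : S m), y ∈ maximalIdeal (S m) → O.valuation (y : L) < 1)
    (hspan : ∀ m, Ideal.span ((fun y : S m => (⟨(y : L), hle m y.2⟩ : S (m + 1))) '' (maximalIdeal (S m) : Set (S m)))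
        = Ideal.span {x m})
    (hpers : ∀ m, Ideal.span {(⟨((x m : S (m + 1)) : L), hle (m + 1) (x m).2⟩ : S (m + 2))} = Ideal.span {x (m + 1)})
    (h0 : maximalIdeal (S 0) ≠ ⊥) (hA₀ : A₀.toSubring ≤ S 0) (hnc : ¬ HasProperCoarsening O) (hnd : ¬ Discrete O) :
    False :=
  haveI : Fact p.Prime := ⟨hp⟩
  false_of_persistentChain O hSO hdom hspan hpers h0 hnc hnd hp.ne_zero fun _ hz =>
    OddBranchPersistence.exists_pow_eq_div_of_isFractionRing_adjoin p A₀ t htp hfr (S 0) hA₀ hz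

end Valued

/-! ## §4 EVENTUAL persistence (the shape (e1) `NoTangentialTailHP` delivers: `span {x m} = span {x (m+1)}` for `m ≥ m₀` only) -/

section Eventually

variable {S : ℕ → Subring L} [∀ m, IsLocalRing (S m)] {hle : ∀ m, S m ≤ S (m + 1)} {x : ∀ m, S (m + 1)}

omit [∀ m, IsLocalRing (S m)] in
/-- Eventual persistence from stage `m₀`: `x m = u · x m₀` in `L` with `u, u⁻¹ ∈ S (m+1)` for every `m ≥ m₀`. [folklore] -/
theorem exists_unit_mul_eq_of_eventuallyPersistent (m₀ : ℕ)
    (hpers : ∀ m, m₀ ≤ m →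
      Ideal.span {(⟨((x m : S (m + 1)) : L), hle (m + 1) (x m).2⟩ : S (m + 2))} = Ideal.span {x (m + 1)})
    (hx0 : ((x m₀ : S (m₀ + 1)) : L) ≠ 0) :
    ∀ m, m₀ ≤ m → ∃ u w : L, u ∈ S (m + 1) ∧ w ∈ S (m + 1) ∧ u * w = 1 ∧
      ((x m : S (m + 1)) : L) = u * ((x m₀ : S (m₀ + 1)) : L) := by
  intro m hm
  induction m, hm using Nat.le_induction with
  | base => exact ⟨1, 1, (S (m₀ + 1)).one_mem, (S (m₀ + 1)).one_mem, one_mul 1, (one_mul _).symm⟩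
  | succ m hm ih =>
    obtain ⟨u, w, hu, hw, huw, hxm⟩ := ih
    have h1 : (⟨((x m : S (m + 1)) : L), hle (m + 1) (x m).2⟩ : S (m + 2)) ∈ Ideal.span {x (m + 1)} := by
      rw [← hpers m hm]; exact Ideal.mem_span_singleton_self _
    have h2 : x (m + 1) ∈ Ideal.span {(⟨((x m : S (m + 1)) : L), hle (m + 1) (x m).2⟩ : S (m + 2))} := by
      rw [hpers m hm]; exact Ideal.mem_span_singleton_self _
    obtain ⟨a, ha⟩ := Ideal.mem_span_singleton'.mp h1
    obtain ⟨b, hb⟩ := Ideal.mem_span_singleton'.mp h2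
    have ha' : ((a : S (m + 2)) : L) * ((x (m + 1) : S (m + 2)) : L) = ((x m : S (m + 1)) : L) := by
      have := congrArg (fun z : S (m + 2) => (z : L)) ha; simpa using this
    have hb' : ((b : S (m + 2)) : L) * ((x m : S (m + 1)) : L) = ((x (m + 1) : S (m + 2)) : L) := by
      have := congrArg (fun z : S (m + 2) => (z : L)) hb; simpa using this
    have hxm0 : ((x m : S (m + 1)) : L) ≠ 0 := by
      rw [hxm]
      have hu0 : u ≠ 0 := fun h => by rw [h, zero_mul] at huw; exact zero_ne_one huw
      exact mul_ne_zero hu0 hx0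
    have hba : ((b : S (m + 2)) : L) * (a : L) = 1 := by
      have h := hb'
      rw [← ha', ← mul_assoc] at h
      have hx10 : ((x (m + 1) : S (m + 2)) : L) ≠ 0 := by
        intro h0; rw [h0, mul_zero] at ha'; exact hxm0 ha'.symm
      exact mul_right_cancel₀ hx10 (by rw [h, one_mul])
    refine ⟨(b : L) * u, w * (a : L), (S (m + 2)).mul_mem b.2 (hle (m + 1) hu),
      (S (m + 2)).mul_mem (hle (m + 1) hw) a.2, ?_, ?_⟩
    · calc (b : L) * u * (w * (a : L)) = ((b : L) * (a : L)) * (u * w) := by ring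
        _ = 1 := by rw [hba, huw, one_mul]
    · rw [← hb', hxm, mul_assoc]

/-- The weak persistence clause from EVENTUAL chain persistence (for the parameter `x m₀`, stages `i ≥ m₀`). [folklore] -/
theorem weakPersistence_of_eventuallyPersistent {O : ValuationSubring L} (hSO : ∀ m, S m ≤ O.toSubring)
    (hspan : ∀ m, Ideal.span ((fun y : S m => (⟨(y : L), hle m y.2⟩ : S (m + 1))) '' (maximalIdeal (S m) : Set (S m)))
        = Ideal.span {x m})
    (m₀ : ℕ)
    (hpers : ∀ m, m₀ ≤ m →
      Ideal.span {(⟨((x m : S (m + 1)) : L), hle (m + 1) (x m).2⟩ : S (m + 2))} = Ideal.span {x (m + 1)})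
    (hx0 : ((x m₀ : S (m₀ + 1)) : L) ≠ 0) :
    ∀ i, m₀ ≤ i → ∀ y ∈ S i, O.valuation y < 1 → ∃ j, i < j ∧ y / ((x m₀ : S (m₀ + 1)) : L) ∈ S j := by
  intro i hi y hy hvy
  have hym : (⟨y, hy⟩ : S i) ∈ maximalIdeal (S i) :=
    QuadraticStep.mem_maximalIdeal_of_valuation_lt_one (hSO i) ⟨y, hy⟩ hvy
  obtain ⟨r, hr, hyr⟩ := exists_eq_mul_excParam hspan i hym
  obtain ⟨u, w, hu, -, -, hxu⟩ := exists_unit_mul_eq_of_eventuallyPersistent m₀ hpers hx0 i hi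
  refine ⟨i + 1, i.lt_succ_self, ?_⟩
  have : y / ((x m₀ : S (m₀ + 1)) : L) = r * u := by
    change (y : L) = _ at hyr
    rw [hyr, hxu, ← mul_assoc, mul_div_assoc, div_self hx0, mul_one]
  rw [this]
  exact (S (i + 1)).mul_mem hr hu

/-- **PERSIST-V, eventual form.** As `discrete_of_persistentChain`, with persistence only from stage `m₀` on (`𝔪_(S m₀) ≠ ⊥`, the
fraction datum at `S m₀`; domination used at `m₀`, `m₀ + 1`). [cite: HeinzerEtAl2015, Remark 2.4] [folklore] -/
theorem discrete_of_eventuallyPersistentChain (O : ValuationSubring L) (hSO : ∀ m, S m ≤ O.toSubring)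
    (hdom : ∀ m (y : S m), y ∈ maximalIdeal (S m) → O.valuation (y : L) < 1)
    (hspan : ∀ m, Ideal.span ((fun y : S m => (⟨(y : L), hle m y.2⟩ : S (m + 1))) '' (maximalIdeal (S m) : Set (S m)))
        = Ideal.span {x m})
    (m₀ : ℕ)
    (hpers : ∀ m, m₀ ≤ m →
      Ideal.span {(⟨((x m : S (m + 1)) : L), hle (m + 1) (x m).2⟩ : S (m + 2))} = Ideal.span {x (m + 1)})
    (h0 : maximalIdeal (S m₀) ≠ ⊥) (hnc : ¬ HasProperCoarsening O) {N : ℕ} (hN : N ≠ 0)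
    (hK : ∀ z : L, z ≠ 0 → ∃ a ∈ S m₀, ∃ b ∈ S m₀, a ≠ 0 ∧ b ≠ 0 ∧ z ^ N = a / b) : Discrete O := by
  -- `x m₀ ≠ 0`
  have hx0 : ((x m₀ : S (m₀ + 1)) : L) ≠ 0 := by
    intro hx
    apply h0
    rw [eq_bot_iff]
    intro y hy
    obtain ⟨r, -, hr⟩ := exists_eq_mul_excParam hspan m₀ hy
    rw [hx, mul_zero] at hr
    exact (Submodule.mem_bot _).mpr (Subtype.ext hr)
  -- `x m₀ ∈ 𝔪_(S (m₀+1))`, hence of value `< 1`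
  have hxmax : (x m₀ : S (m₀ + 1)) ∈ maximalIdeal (S (m₀ + 1)) := by
    have hle1 : Ideal.span ((fun y : S m₀ => (⟨(y : L), hle m₀ y.2⟩ : S (m₀ + 1))) ''
        (maximalIdeal (S m₀) : Set (S m₀))) ≤ maximalIdeal (S (m₀ + 1)) := by
      refine Ideal.span_le.mpr ?_
      rintro _ ⟨y, hy, rfl⟩
      exact QuadraticStep.mem_maximalIdeal_of_valuation_lt_one (hSO (m₀ + 1)) _ (hdom m₀ y hy)
    exact hle1 ((hspan m₀).symm ▸ Ideal.mem_span_singleton_self (x m₀))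
  have hvx : O.valuation ((x m₀ : S (m₀ + 1)) : L) < 1 := hdom (m₀ + 1) _ hxmax
  have hxO : ((x m₀ : S (m₀ + 1)) : L) ∈ O := hSO (m₀ + 1) (x m₀).2
  exact OddBranchVFree.discrete_of_persistent' O (fun m => S m) ((x m₀ : S (m₀ + 1)) : L) m₀ N hSO ⟨hxO, hvx⟩ hx0
    (weakPersistence_of_eventuallyPersistent hSO hspan m₀ hpers hx0) hnc hN hK

omit [∀ m, IsLocalRing (S m)] in
/-- Members of the chain increase: `S i ≤ S j` for `i ≤ j`. [folklore] -/
theorem le_of_le (hle : ∀ m, S m ≤ S (m + 1)) {i j : ℕ} (hij : i ≤ j) : S i ≤ S j :=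
  (monotone_nat_of_le_succ hle) hij

/-- **PERSIST-V, eventual torsor form, contradiction** — the shape strat-2's (e3) glue consumes: a chain inside `O` dominated by
`O` with the span clause, EVENTUALLY persistent (`m ≥ m₀`: the conclusion of (e1) `NoTangentialTailHP`), members of positive
dimension, `t ^ p ∈ A₀ ⊆ S 0`, `K = Frac k[A₀, t]`, and `O` rank-one non-discrete (`¬ HasProperCoarsening`, `¬ Discrete` — from
`CoreDatum`) is impossible. [folklore] -/
theorem false_of_eventuallyPersistentChain_torsor {k : Type} [Field k] [Algebra k L] (p : ℕ) (hp : p.Prime) [CharP L p]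
    (A₀ : Subalgebra k L) (t : L) (htp : t ^ p ∈ A₀) (hfr : IsFractionRing (Algebra.adjoin k (insert t (A₀ : Set L))) L)
    (O : ValuationSubring L) (hSO : ∀ m, S m ≤ O.toSubring)
    (hdom : ∀ m (y : S m), y ∈ maximalIdeal (S m) → O.valuation (y : L) < 1)
    (hspan : ∀ m, Ideal.span ((fun y : S m => (⟨(y : L), hle m y.2⟩ : S (m + 1))) '' (maximalIdeal (S m) : Set (S m)))
        = Ideal.span {x m})
    (m₀ : ℕ)
    (hpers : ∀ m, m₀ ≤ m →
      Ideal.span {(⟨((x m : S (m + 1)) : L), hle (m + 1) (x m).2⟩ : S (m + 2))} = Ideal.span {x (m + 1)})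
    (h0 : ∀ m, maximalIdeal (S m) ≠ ⊥) (hA₀ : A₀.toSubring ≤ S 0) (hnc : ¬ HasProperCoarsening O)
    (hnd : ¬ Discrete O) : False :=
  haveI : Fact p.Prime := ⟨hp⟩
  hnd (discrete_of_eventuallyPersistentChain O hSO hdom hspan m₀ hpers (h0 m₀) hnc hp.ne_zero fun _ hz =>
    OddBranchPersistence.exists_pow_eq_div_of_isFractionRing_adjoin p A₀ t htp hfr (S m₀)
      (hA₀.trans (le_of_le hle (Nat.zero_le m₀))) hz)

end Eventually

end PersistentChainValued

end Summit.ResolutionOfSingularities.ResolutionOfSingularities.Theorems.SwitchingDichotomy
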